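import Mathlib

/-!
# Hub selection from two heavy-mass profiles

Crux `Summit.MatrixMultiplication.MatrixMultiplication.Theses.SnSubsetDichotomy.PolynomialSlack`
(item `stmt-MatrixMultiplication-8306`), level-one programme, line transport-split-hull, HUB SELECTION.
`σ_k, ρ_k ∈ [0,1]` are the heavy masses of column `k` of one quotient profile and of row `k` of another;
their totals are `≤ Λ` (`Λ ≥ 1`), one of the two totals is even `≤ 1 + δ₄` (pair-collision bound), and the
pinning forces `Σ_k σ_k ρ_k ≥ 1 - δ` with `δ + δ₄ ≤ 1/(64Λ²)`. Conclusion (`exists_hub_of_masses`): some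
position `k` is a hub for both profiles, `σ_k + ρ_k - 1 ≥ 1/(4Λ)`.

Proof (case `Σ ρ ≤ 1 + δ₄`, the other being symmetric). If every `k` had `4Λ(σ_k + ρ_k - 1) < 1`, then
for each `k` either `4Λ(1 - σ_k) ≤ 1`, whence `4Λρ_k ≤ 2` and `4Λσ_kρ_k ≤ 2σ_k`, or `4Λ(1-σ_k) > 1`,
whence `4Λσ_kρ_k ≤ 4Λρ_k ≤ 16Λ²ρ_k(1-σ_k)`; in both cases
`(4Λ + 16Λ²) σ_kρ_k ≤ 2σ_k + 16Λ² ρ_k(1 - σ_k) + 16Λ² σ_kρ_k`, i.e.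
`(4Λ + 16Λ²) σ_kρ_k ≤ 2σ_k + 16Λ²ρ_k`. Summing, `(4Λ+16Λ²)(1-δ) ≤ 2Λ + 16Λ²(1+δ₄)`, i.e.
`2Λ ≤ 4Λδ + 16Λ²(δ + δ₄) ≤ 20Λ²(δ+δ₄) ≤ 20/64 < 2`, a contradiction.
-/

namespace Summit.MatrixMultiplication.MatrixMultiplication.Theorems.PolynomialSlack

open scoped BigOperators

-- `Summit.<Summit>.<Problem>` is the tree's mandated summit-side namespace (CONVENTIONS §2); for
-- this single-conjunct summit the two coincide, so each declaration silences `dupNamespace`.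
set_option linter.dupNamespace false

/-- **Hub selection, one-sided form.** If `σ_k ∈ [0,1]`, `ρ_k ≥ 0`, `Σ σ ≤ Λ` (`Λ ≥ 1`),
`Σ ρ ≤ 1 + δ₄`, `Σ σ_kρ_k ≥ 1 - δ` and `δ + δ₄ ≤ 1/(64Λ²)` (`δ, δ₄ ≥ 0`), then some `k` has
`σ_k + ρ_k - 1 ≥ 1/(4Λ)`. [folklore] -/
theorem exists_hub_of_masses_of_sum_le {ι : Type*} [Fintype ι] (σ ρ : ι → ℝ) (Λ δ δ₄ : ℝ)
    (hσ0 : ∀ k, 0 ≤ σ k) (hσ1 : ∀ k, σ k ≤ 1) (hρ0 : ∀ k, 0 ≤ ρ k) (hΛ : 1 ≤ Λ)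
    (hσΛ : ∑ k, σ k ≤ Λ) (hδ : 0 ≤ δ) (hδ₄ : 0 ≤ δ₄) (hsmall : δ + δ₄ ≤ 1 / (64 * Λ ^ 2))
    (hρ : ∑ k, ρ k ≤ 1 + δ₄) (hmass : 1 - δ ≤ ∑ k, σ k * ρ k) :
    ∃ k, 1 / (4 * Λ) ≤ σ k + ρ k - 1 := by
  by_contra! h
  have hΛpos : 0 < Λ := by linarith
  -- the pointwise inequality behind the case split `σ_k ≥ 1 - 1/(4Λ)` or not
  have key : ∀ k, (4 * Λ + 16 * Λ ^ 2) * (σ k * ρ k) ≤ 2 * σ k + 16 * Λ ^ 2 * ρ k := by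
    intro k
    have hk : (σ k + ρ k - 1) * (4 * Λ) < 1 := (lt_div_iff₀ (by positivity)).mp (h k)
    rcases le_or_gt (4 * Λ * (1 - σ k)) 1 with hA | hB
    · have hρ2 : Λ * ρ k ≤ 1 / 2 := by nlinarith
      nlinarith [mul_nonneg (hσ0 k) (sub_nonneg.mpr hρ2),
        mul_nonneg (mul_nonneg (sq_nonneg Λ) (hρ0 k)) (sub_nonneg.mpr (hσ1 k))]
    · nlinarith [mul_nonneg (mul_nonneg hΛpos.le (hρ0 k)) (sub_nonneg.mpr (hσ1 k)),
        mul_nonneg (mul_nonneg hΛpos.le (hρ0 k)) (sub_nonneg.mpr hB.le), hσ0 k]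
  have hsum : (4 * Λ + 16 * Λ ^ 2) * ∑ k, σ k * ρ k ≤ 2 * ∑ k, σ k + 16 * Λ ^ 2 * ∑ k, ρ k := by
    rw [Finset.mul_sum, Finset.mul_sum, Finset.mul_sum, ← Finset.sum_add_distrib]
    exact Finset.sum_le_sum fun k _ => key k
  have h64 : (δ + δ₄) * (64 * Λ ^ 2) ≤ 1 := (le_div_iff₀ (by positivity)).mp hsmall
  nlinarith [mul_le_mul_of_nonneg_left hρ (sq_nonneg Λ),
    mul_le_mul_of_nonneg_left hmass (by positivity : (0 : ℝ) ≤ 4 * Λ + 16 * Λ ^ 2),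
    mul_nonneg (mul_nonneg (sub_nonneg.mpr hΛ) hΛpos.le) hδ, mul_nonneg (sq_nonneg Λ) hδ₄]

/-- **Hub selection.** Let `σ_k, ρ_k ∈ [0,1]` (`k` ranging over a finite type) with `Σ σ ≤ Λ`,
`Σ ρ ≤ Λ` (`Λ ≥ 1`), one of the two totals even `≤ 1 + δ₄`, and `Σ_k σ_kρ_k ≥ 1 - δ`, where
`δ, δ₄ ≥ 0` and `δ + δ₄ ≤ 1/(64Λ²)`. Then some position `k` is a hub for both:
`1/(4Λ) ≤ σ_k + ρ_k - 1`. [folklore] -/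
theorem exists_hub_of_masses {ι : Type*} [Fintype ι] (σ ρ : ι → ℝ) (Λ δ δ₄ : ℝ)
    (hσ0 : ∀ k, 0 ≤ σ k) (hσ1 : ∀ k, σ k ≤ 1) (hρ0 : ∀ k, 0 ≤ ρ k) (hρ1 : ∀ k, ρ k ≤ 1)
    (hΛ : 1 ≤ Λ) (hσΛ : ∑ k, σ k ≤ Λ) (hρΛ : ∑ k, ρ k ≤ Λ) (hδ : 0 ≤ δ) (hδ₄ : 0 ≤ δ₄)
    (hsmall : δ + δ₄ ≤ 1 / (64 * Λ ^ 2))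
    (hsharp : ∑ k, σ k ≤ 1 + δ₄ ∨ ∑ k, ρ k ≤ 1 + δ₄)
    (hmass : 1 - δ ≤ ∑ k, σ k * ρ k) : ∃ k, 1 / (4 * Λ) ≤ σ k + ρ k - 1 := by
  rcases hsharp with hσs | hρs
  · -- the sharp total is `Σ σ`: swap the roles of `σ` and `ρ`
    obtain ⟨k, hk⟩ := exists_hub_of_masses_of_sum_le ρ σ Λ δ δ₄ hρ0 hρ1 hσ0 hΛ hρΛ hδ hδ₄ hsmall
      hσs (hmass.trans_eq (Finset.sum_congr rfl fun k _ => mul_comm (σ k) (ρ k)))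
    exact ⟨k, by linarith⟩
  · exact exists_hub_of_masses_of_sum_le σ ρ Λ δ δ₄ hσ0 hσ1 hρ0 hΛ hσΛ hδ hδ₄ hsmall hρs hmass

end Summit.MatrixMultiplication.MatrixMultiplication.Theorems.PolynomialSlack
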